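import Summits.BirchSwinnertonDyer.BirchSwinnertonDyer.Theses.PAdicOrderV2
import Summits.BirchSwinnertonDyer.BirchSwinnertonDyer.Theses.SelmerRank
import Summits.BirchSwinnertonDyer.BirchSwinnertonDyer.Theorems.SelmerRankShaCorank
import Summits.BirchSwinnertonDyer.BirchSwinnertonDyer.Theorems.PAdicOrderV2PAdicOrderComparisonR2StubConstantCoeff
import Summits.BirchSwinnertonDyer.BirchSwinnertonDyer.Theorems.PAdicOrderV2PAdicOrderComparisonR2StubTwoLeOrder
import Summits.BirchSwinnertonDyer.BirchSwinnertonDyer.Theorems.PAdicOrderV2PAdicOrderComparisonR2StubKerMulTRatSqEq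
import Summits.BirchSwinnertonDyer.BirchSwinnertonDyer.Theorems.PAdicOrderV2PAdicOrderComparisonR2StubOrderEqSelmerCorank
import Summits.BirchSwinnertonDyer.BirchSwinnertonDyer.Theorems.PAdicOrderV2PAdicOrderComparisonR2OfItems
import Literature.NumberTheory.EllipticCurves.PAdicBSD
import Literature.NumberTheory.EllipticCurves.SelmerCorankControl
import Literature.NumberTheory.EllipticCurves.KatoRankBoundSelmerProofs
import Literature.NumberTheory.EllipticCurves.IwasawaSelmerDualProofs
import Literature.NumberTheory.EllipticCurves.SelmerInftyTorsionFiniteProofs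
import Literature.NumberTheory.EllipticCurves.OrdinaryPrimesProofs

/-!
# Crux #2 `PAdicOrderComparisonR2` at every ODD good ordinary prime from the route items and
# Mazur control (line `Sketch`, skeleton v10, lead c3 — helper file, `--supports stmt-BirchSwinnertonDyer-0489`)

Skeleton v9 of line `Sketch` (`Cruxes/PAdicOrderComparisonR2/Lines/Sketch.lean`) left, at odd `p`,
one stub outside the route items: SEL3, the `p = 3` Selmer side
`corank_{ℤ_3} Sel_{3^∞}(E/ℚ) = ord_{s=1} L(E,s)` (route SelmerRank's cruxes `SelmerRankLB` /
`SelmerRankUB` / `SelmerRankSmallImage` carry `5 ≤ p`). v10 observes that the Selmer side at EVERY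
prime is already a consequence of route SelmerRank's items, through the rank:

* `mordellWeilRank_eq_analyticRank_of_selmerRankItems` — `rank E(ℚ) = ord_{s=1} L(E,s)` for every
  globally minimal elliptic `W/ℚ` from `SelmerRankLB` ∧ `SelmerRankUB` ∧ `SelmerRankSmallImage`
  (stmt-0131/0130/14418: `corank Sel_{p^∞} = r_an` at good ordinary `p ≥ 5`) and `SelmerRankShaPFinite`
  (stmt-0132: `Ш(E/ℚ)[p^∞]` finite for every `p`): take a good ordinary `p₀ ≥ 5` (tree theorem
  `WeierstrassCurve.exists_good_ordinary_prime_holds`), then `r_an = corank Sel_{p₀^∞} = rank +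
  corank Ш[p₀^∞] = rank` (Kummer identity `selmerCorank_eq_mordellWeilRank_add_holds`; a finite
  `p`-primary group has corank `0`, `Literature.BSD.shaCorank_eq_zero_of_finite`) — this is route
  SelmerRank's own `CruxesToThesis ∘ Assembly` chain, restricted to globally minimal models;
* `selmerCorank_eq_analyticRank_of_selmerRankItems` — hence `corank_{ℤ_p} Sel_{p^∞}(E/ℚ) = r_an`
  at EVERY prime `p` (Kummer identity and `Ш[p^∞]` finite again), in particular at `p = 3` (the v9
  stub SEL3) and at `p = 2`;
* `pAdicOrderComparisonR2_odd_of_items` — consequently crux #2 at every ODD good ordinary prime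
  follows from the seven route items crux #5 `PAdicOrderRankOneR4` (0515), `SelmerRankLB` /
  `SelmerRankUB` / `SelmerRankSmallImage` / `SelmerRankShaPFinite` (0131/0130/14418/0132), crux #4
  `PAdicOrderSemisimpleR3` (0509), crux #7 `PAdicOrderMainConjectureR7` (15426) and ONE named
  Literature fact, Mazur's control theorem in corank form
  `Greenberg1999_coinvariantsRank_eq_selmerCorank_rat`, exactly as the `5 ≤ p` slice
  (`pAdicOrderComparisonR2_five_le_of_items`, file `…OfItems.lean`) but with the Selmer side taken
  from `selmerCorank_eq_analyticRank_of_selmerRankItems`. Only the `p = 2` residue of the crux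
  (stub RES2: no Kato divisibility / main conjecture / semisimplicity input at `p = 2` in the tree)
  remains outside.

References: B. Mazur, J. Tate, J. Teitelbaum, Invent. Math. 84 (1986), §II.10; R. Greenberg, LNM
1716 (1999), §1 (p. 63: `corank Sel = rank + corank Ш`), Thm 1.2; K. Kato, Astérisque 295 (2004),
Thm 17.4, 18.4.
-/

-- the problem directory `BirchSwinnertonDyer/BirchSwinnertonDyer` forces the duplicated namespace segment
set_option linter.dupNamespace false

namespace Summit.BirchSwinnertonDyer.BirchSwinnertonDyer.Theorems

open Summit.BirchSwinnertonDyer.BirchSwinnertonDyer.Theses.PAdicOrderV2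
open Summit.BirchSwinnertonDyer.BirchSwinnertonDyer.Theses.SelmerRank (SelmerRankLB SelmerRankUB
  SelmerRankSmallImage SelmerRankShaPFinite)
open Literature.NumberTheory.EllipticCurves

/-- **`rank E(ℚ) = ord_{s=1} L(E,s)` for globally minimal `W` from route SelmerRank's items.** From
`SelmerRankLB` ∧ `SelmerRankUB` ∧ `SelmerRankSmallImage` (`corank_{ℤ_p} Sel_{p^∞}(E/ℚ) = r_an` at
every good ordinary `p ≥ 5`, split on the surjectivity of `ρ̄_{E,p}`) and `SelmerRankShaPFinite`
(`Ш(E/ℚ)[p^∞]` finite for every `p`): at a good ordinary `p₀ ≥ 5`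
(`WeierstrassCurve.exists_good_ordinary_prime_holds`), `r_an = corank Sel_{p₀^∞} = rank + corank
Ш[p₀^∞]` (`WeierstrassCurve.selmerCorank_eq_mordellWeilRank_add_holds`) `= rank`
(`Literature.BSD.shaCorank_eq_zero_of_finite`). Greenberg, LNM 1716, §1 p. 63.
[cite: GreenbergLNM1716, §1 p. 63] -/
theorem mordellWeilRank_eq_analyticRank_of_selmerRankItems (hLB : SelmerRankLB) (hUB : SelmerRankUB)
    (hSI : SelmerRankSmallImage) (hSha : SelmerRankShaPFinite) (W : WeierstrassCurve ℚ)
    [W.IsElliptic] [W.IsGloballyMinimal] : W.mordellWeilRank = W.analyticRank := by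
  obtain ⟨p, hp, hp5, hgood, hord⟩ := WeierstrassCurve.exists_good_ordinary_prime_holds W
  have hsel : W.selmerCorank p = W.analyticRank := by
    by_cases hs : W.HasSurjectiveModNGaloisRep p
    · exact le_antisymm (hUB W p hp5 hgood hord hs) (hLB W p hp5 hgood hord hs)
    · exact hSI W p hp5 hgood hord hs
  have hkummer : W.selmerCorank p = W.mordellWeilRank + W.shaCorank p :=
    W.selmerCorank_eq_mordellWeilRank_add_holds p
  have hsha : W.shaCorank p = 0 := Literature.BSD.shaCorank_eq_zero_of_finite W p (hSha W p)
  omega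

/-- **The Selmer side at EVERY prime from route SelmerRank's items**: for globally minimal elliptic
`W/ℚ` and any prime `p`, `corank_{ℤ_p} Sel_{p^∞}(E/ℚ) = ord_{s=1} L(E,s)` — the Kummer identity
`corank Sel_{p^∞} = rank + corank Ш[p^∞]` (`selmerCorank_eq_mordellWeilRank_add_holds`), `Ш[p^∞]`
finite (`SelmerRankShaPFinite`) and `rank = r_an`
(`mordellWeilRank_eq_analyticRank_of_selmerRankItems`). In particular the `p = 3` Selmer side
(the v9 stub SEL3 of line `Sketch`) and the `p = 2` one. [cite: GreenbergLNM1716, §1 p. 63] -/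
theorem selmerCorank_eq_analyticRank_of_selmerRankItems (hLB : SelmerRankLB) (hUB : SelmerRankUB)
    (hSI : SelmerRankSmallImage) (hSha : SelmerRankShaPFinite) (W : WeierstrassCurve ℚ)
    [W.IsElliptic] [W.IsGloballyMinimal] (p : ℕ) [Fact p.Prime] :
    W.selmerCorank p = W.analyticRank := by
  have hkummer : W.selmerCorank p = W.mordellWeilRank + W.shaCorank p :=
    W.selmerCorank_eq_mordellWeilRank_add_holds p
  have hsha : W.shaCorank p = 0 := Literature.BSD.shaCorank_eq_zero_of_finite W p (hSha W p)
  have hr := mordellWeilRank_eq_analyticRank_of_selmerRankItems hLB hUB hSI hSha W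
  omega

/-- **Crux #2 at every ODD good ordinary prime, from the seven route items and Mazur's control
theorem alone.** For `E/ℚ` (globally minimal `W`), `p ≠ 2` good ordinary and the newform `f` of `E`:
`ord_{T=0} L_p(f, α_p, T) = ord_{s=1} L(E,s)` in `ℕ∞`, assuming crux #5 `PAdicOrderRankOneR4`
(rank one), route SelmerRank's `SelmerRankLB` / `SelmerRankUB` / `SelmerRankSmallImage` /
`SelmerRankShaPFinite`, crux #4 `PAdicOrderSemisimpleR3`, crux #7 `PAdicOrderMainConjectureR7` and
the named tree fact `Greenberg1999_coinvariantsRank_eq_selmerCorank_rat` (Mazur control in corank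
form). Cases: `r_an = 0` by interpolation (`stub_constantCoeff_eq_zero_iff`); `r_an = 1` is crux #5;
`r_an ≥ 2`: `≤` is `ord_T L_p = ord_T g = rank X/TX = corank Sel = r_an` (item MC; semisimplicity
through the landed SS-bridge `stub_ker_mulTRat_sq_eq`; control; the landed bookkeeping
`stub_order_eq_selmerCorank`; the Selmer side `selmerCorank_eq_analyticRank_of_selmerRankItems`),
`≥` is parity in rank 2 (`stub_two_le_order_of_analyticRank_eq_two`) and
`r_an = corank Sel ≤ ord_T L_p` (`selmerCorank_le_order_of_mainConjectureR7`) in rank `≥ 3`. Only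
the `p = 2` residue of the crux is not covered. [cite: MazurTateTeitelbaum1986Invent, §II.10]
[cite: GreenbergLNM1716, Thm. 1.2 and §1 p. 65] -/
theorem pAdicOrderComparisonR2_odd_of_items :
    Summit.BirchSwinnertonDyer.BirchSwinnertonDyer.Theses.PAdicOrderV2.PAdicOrderRankOneR4 →
    Summit.BirchSwinnertonDyer.BirchSwinnertonDyer.Theses.SelmerRank.SelmerRankLB →
    Summit.BirchSwinnertonDyer.BirchSwinnertonDyer.Theses.SelmerRank.SelmerRankUB →
    Summit.BirchSwinnertonDyer.BirchSwinnertonDyer.Theses.SelmerRank.SelmerRankSmallImage →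
    Summit.BirchSwinnertonDyer.BirchSwinnertonDyer.Theses.SelmerRank.SelmerRankShaPFinite →
    Summit.BirchSwinnertonDyer.BirchSwinnertonDyer.Theses.PAdicOrderV2.PAdicOrderSemisimpleR3 →
    Summit.BirchSwinnertonDyer.BirchSwinnertonDyer.Theses.PAdicOrderV2.PAdicOrderMainConjectureR7 →
    Literature.NumberTheory.EllipticCurves.Greenberg1999_coinvariantsRank_eq_selmerCorank_rat →
    ∀ (W : WeierstrassCurve ℚ) [W.IsElliptic] [W.IsGloballyMinimal] (p : ℕ) [Fact p.Prime],
      p ≠ 2 → Literature.NumberTheory.EllipticCurves.IsOrdinaryAt W p →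
      ∀ {N : ℕ} [NeZero N] (f : CuspForm (CongruenceSubgroup.Gamma0 N) 2),
        Literature.NumberTheory.EllipticCurves.ModularForms.IsNewformOf W f →
          (Literature.NumberTheory.EllipticCurves.padicLFunction f
            (Literature.NumberTheory.EllipticCurves.unitRoot W p : ℚ_[p])).order = W.analyticRank := by
  intro h5 hLB hUB hSI hSha hSS hMC hCT W _ _ p _ hp2 hord N _ f hf
  have hp3 : 3 ≤ p := by
    have := (Fact.out : p.Prime).two_le
    omega
  have h1 := stub_constantCoeff_eq_zero_iff W p hord f hf
  have hsel : W.selmerCorank p = W.analyticRank :=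
    selmerCorank_eq_analyticRank_of_selmerRankItems hLB hUB hSI hSha W p
  rcases Nat.lt_or_ge W.analyticRank 1 with h0 | hpos
  · -- analytic rank 0: the constant term is a unit of ℚ_p, so the T-order is 0
    have hr : W.analyticRank = 0 := by omega
    have hc : PowerSeries.constantCoeff (Literature.NumberTheory.EllipticCurves.padicLFunction f
        (Literature.NumberTheory.EllipticCurves.unitRoot W p : ℚ_[p])) ≠ 0 := by
      intro h
      have := h1.mp h
      omega
    rw [hr, Nat.cast_zero]
    refine PowerSeries.order_eq_nat.mpr ⟨?_, fun i hi => (Nat.not_lt_zero i hi).elim⟩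
    simpa only [PowerSeries.coeff_zero_eq_constantCoeff] using hc
  · rcases Nat.lt_or_ge W.analyticRank 2 with hlt2 | h2
    · -- analytic rank 1: crux #5
      have hr : W.analyticRank = 1 := by omega
      rw [hr, Nat.cast_one]
      exact h5 W p hord hr f hf
    · apply le_antisymm
      · -- upper bound: MC item, SS item + SS-bridge, control fact, BK, Selmer side
        obtain ⟨κ, hκ, γ, hγ, hγ'⟩ := exists_isCyclotomic_isTopGenerator_isCyclotomicVariable_holds p
        obtain ⟨D⟩ := W.nonempty_selmerDualData_holds κ γ hγ
        obtain ⟨htors, hmc⟩ := hMC W p hp3 hord.1 hord.2 κ γ hκ hγ hγ' f hf D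
        have hss := stub_ker_mulTRat_sq_eq p D.X (hSS W p hp2 hord.1 hord.2 κ γ hκ hγ D)
        have hctrl := (hCT W p hord.1 hord.2 κ γ hκ hγ D).2
        have hoc := stub_order_eq_selmerCorank W p κ γ hκ hγ f D htors hmc hss hctrl
        rw [hoc, hsel]
      · -- lower bound: parity in rank 2, K-from-item in rank ≥ 3
        rcases Nat.lt_or_ge W.analyticRank 3 with hlt3 | _
        · have hr : W.analyticRank = 2 := by omega
          rw [hr, Nat.cast_ofNat]
          exact stub_two_le_order_of_analyticRank_eq_two W p hord f hf hr
        · rw [← hsel]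
          exact selmerCorank_le_order_of_mainConjectureR7 hMC W p hp2 hord f hf

end Summit.BirchSwinnertonDyer.BirchSwinnertonDyer.Theorems
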